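import Mathlib
import Summits.Ventures.PercRepro2.LocRows
import Summits.Ventures.PercRepro2.SwRow
import Summits.Ventures.PercRepro2.SwOut
import Summits.Ventures.PercRepro2.SwAllRow
import Summits.Ventures.PercRepro2.SwOutAll
import Summits.Ventures.PercRepro2.SwOutReducible
import Summits.Ventures.PercRepro2.SwOutJunctionH1Defs
import Summits.Ventures.PercRepro2.SwOutJunctionH1EdgeThm

/-!
# An instance of Theorem A with the edge `h–u` (blind cell PercRepro2, night-4 g29, 2026-08-28;
proofs/NIGHT4-G29.md §5)

`ex7e` (`Fin 7`, 11 edges; `l = 0`, `h = 1`, `o = 2`): the junction `u = 3` is joined to `h` by the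
single edge `e₀ = 0`, has the h-arm `a = 4` (joined to `h`, `u` and `l`) and the pure component
`{c = 5, d = 6, o = 2}` (`c, d` joined to `l`, `o` joined to `l`, `c` and `d`).  No vertex of
`V ∖ {l, h, o}` other than `u` misses an edge to `l`, no non-mark vertex has degree `≤ 2`, and `u`
is joined to `h` by the two edge-disjoint paths `u–h` and `u–a–h` — so no theorem of record of the
junction lane (the hadj junctions, the pure junctions, the bridge and never-core criteria, the
series / leaf reductions) settles it; `sw_of_junctionH1_edge` does (`sw_ex7e`).
-/

namespace Summit.Ventures.PercRepro2

namespace LocRows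

open Hull

/-- A component of `G[U ∖ {h, u}]` lies in any set `S ∋ p` closed under the edges inside
`U ∖ {h, u}`. -/
lemma compU_subset_of_closed {V : Type*} {E : Type*} {ends : E → Sym2 V} {U : Set V} {h u p : V}
    (S : Set V) (hp : p ∈ S)
    (hS : ∀ e x y, ends e = s(x, y) → x ∈ U \ {h, u} → y ∈ U \ {h, u} → x ∈ S → y ∈ S) :
    compU ends U h u p ⊆ S := by
  intro v hv
  refine mem_of_conn_of_closed (ends := ends) (S := S) ?_ hp hv
  intro a ha b hab
  obtain ⟨_, e, he, hends⟩ := openGraph_adj.1 hab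
  have he' : e ∈ within ends (U \ {h, u}) := by simpa using he
  obtain ⟨x, hx, y, hy, hxy⟩ := he'
  rw [hends, Sym2.eq_iff] at hxy
  rcases hxy with ⟨rfl, rfl⟩ | ⟨rfl, rfl⟩
  · exact hS e a b hends hx hy ha
  · exact hS e a b hends hy hx ha

/-- The instance: `l = 0`, `h = 1`, `o = 2`, the junction `u = 3`, its h-arm `a = 4`, its pure
component `{5, 6, 2}`. -/
def ex7e : Fin 11 → Sym2 (Fin 7)
  | 0 => s(1, 3) | 1 => s(4, 1) | 2 => s(3, 4) | 3 => s(4, 0) | 4 => s(3, 5) | 5 => s(5, 6)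
  | 6 => s(5, 0) | 7 => s(6, 0) | 8 => s(6, 2) | 9 => s(2, 0) | 10 => s(5, 2)

/-- (H1) for `ex7e` in the region `{l}ᶜ`: the neighbour `h` of `u` is alone in its component (it is
outside `U ∖ {h, u}`), the neighbour `4` is adjacent to `h`, the neighbour `5` lies in the component
`{2, 5, 6}`, which has no neighbour of `h`. -/
theorem ex7e_H1 : H1 ex7e ({0}ᶜ) 1 3 := by
  intro e p hep
  fin_cases e
  · -- `p = 1 = h`
    have hp : p = 1 := by
      simp only [ex7e, Sym2.eq_iff] at hep
      omega
    subst hp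
    right
    intro q hq e' he'
    have hq1 : q = 1 := compU_subset_of_closed {1} rfl (by
      intro e x y _ hx _ hxS
      exfalso
      rw [Set.mem_singleton_iff] at hxS
      subst hxS
      exact hx.2 (by simp)) hq
    subst hq1
    fin_cases e' <;> simp [ex7e] at he'
  · exfalso
    simp only [ex7e, Sym2.eq_iff] at hep
    omega
  · -- `p = 4`
    have hp : p = 4 := by
      simp only [ex7e, Sym2.eq_iff] at hep
      omega
    subst hp
    exact Or.inl ⟨1, rfl⟩
  · exfalso
    simp only [ex7e, Sym2.eq_iff] at hep
    omega
  · -- `p = 5`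
    have hp : p = 5 := by
      simp only [ex7e, Sym2.eq_iff] at hep
      omega
    subst hp
    right
    intro q hq e' he'
    have hqS : q ∈ ({2, 5, 6} : Set (Fin 7)) := compU_subset_of_closed {2, 5, 6} (by simp) (by
      intro e x y hexy hx hy hxS
      simp only [Set.mem_insert_iff, Set.mem_singleton_iff] at hxS ⊢
      simp only [Set.mem_sdiff, Set.mem_compl_iff, Set.mem_singleton_iff, Set.mem_insert_iff,
        not_or] at hx hy
      fin_cases e <;> simp only [ex7e, Sym2.eq_iff] at hexy <;>
        rcases hexy with ⟨rfl, rfl⟩ | ⟨rfl, rfl⟩ <;> simp_all) hq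
    simp only [Set.mem_insert_iff, Set.mem_singleton_iff] at hqS
    rcases hqS with rfl | rfl | rfl <;> fin_cases e' <;> simp [ex7e] at he'
  all_goals
    exfalso
    simp only [ex7e, Sym2.eq_iff] at hep
    omega

/-- **Row (SW) on `ex7e`**: the (H1) junction `3` adjacent to `h = 1` — Theorem A with the edge
`h–u`. -/
theorem sw_ex7e : Sw ex7e 0 1 2 := by
  refine sw_of_junctionH1_edge (l := 0) (h := 1) (o := 2) (u := 3) (e₀ := 0) (by decide) (by decide)
    (by decide) (by decide) rfl (by decide) ex7e_H1 ?_
  · intro x hx0 hx1 hx2 hx3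
    fin_cases x
    · exact absurd rfl hx0
    · exact absurd rfl hx1
    · exact absurd rfl hx2
    · exact absurd rfl hx3
    · exact ⟨3, rfl⟩
    · exact ⟨6, rfl⟩
    · exact ⟨7, rfl⟩

end LocRows

end Summit.Ventures.PercRepro2
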